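import Literature.NumberTheory.IwasawaTheory.ClassicalMuInvariant
import Literature.NumberTheory.EllipticCurves.ZpExtensionUnramifiedProofs
import Literature.NumberTheory.EllipticCurves.AnticyclotomicInertiaAboveP
import Literature.NumberTheory.GaloisRepresentations.RamificationFiltrationProofs
import Literature.NumberTheory.GaloisRepresentations.IntegralGaloisActionProofs
import Literature.GroupTheory.PadicIntCompactImageProofs
import HarnessLib

/-!
# Washington, Lemma 13.3 (second half): every `ℤ_p`-extension of a number field has a FUKUDA INDEX —
# there is `n₀` such that every prime ramified in `K_∞/K` is totally ramified in `K_∞/K_{n₀}`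
# (`∃ n₀, TotallyRamifiedFrom κ n₀`); anticyclotomic corollary over an imaginary quadratic field

Topic `Literature/NumberTheory/IwasawaTheory`, namespace `Literature.NumberTheory.IwasawaTheory` (the
namespace of `TotallyRamifiedFrom`, `ClassicalMuInvariant.lean` §5). THEOREMS ONLY (no definition, no
named fact, no instance): this file PROVES, in the tree's choice-free language of
`Literature.NumberTheory.EllipticCurves.ZpExtension` (`κ : Γ_K →ₜ* ℤ_p` onto, `ker κ = Gal(K̄/K_∞)`,
`κ.layerSubgroup n = κ⁻¹(pⁿℤ_p) = Gal(K̄/K_n)`) and of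
`Literature.NumberTheory.GaloisRepresentations.absIntegers` (primes `𝔓` of `\bar ℤ_K` above a finite
place `w`, Mathlib's inertia group `𝔓.inertia Γ_K`), the existence statement that the docstring of
`TotallyRamifiedFrom` records informally and that every consumer of Fukuda's hypothesis so far had to
CARRY (`(hκ : TotallyRamifiedFrom κ n₀)` in `ClassicalMuInvariant.lean`,
`Literature/NumberTheory/EllipticCurves/FineSelmerMuRoadDoors.lean`, …):

* `inertia_smul_sup_kerSubgroup` — `I_{τ•𝔓} · Gal(K̄/K_∞) = I_𝔓 · Gal(K̄/K_∞)`: the inertia group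
  of a prime of `K_∞` in the ABELIAN group `Gal(K_∞/K) = Γ_K / ker κ` does not depend on the prime of
  `\bar ℤ_K` chosen above the place (conjugate primes have conjugate inertia groups,
  `Ideal.inertia_smul`);
* `inertia_le_kerSubgroup_or_exists_layerSubgroup_le` — for ONE prime `𝔓`: either `I_𝔓 ≤ ker κ`
  (unramified in `K_∞/K`) or `Gal(K̄/K_e) ≤ I_𝔓 · ker κ` for some `e` (totally ramified in `K_∞/K_e`):
  the image `κ(I_𝔓)` of the COMPACT group `I_𝔓` (closed in `Γ_K`,
  `absIntegers.isClosed_inertia_holds`) is a closed subgroup of `ℤ_p`, hence `0` or `p^e ℤ_p`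
  (`Literature.GroupTheory.kappa_eq_one_or_exists_image_eq_span_pow`);
* **`exists_totallyRamifiedFrom`** — `∃ n₀, TotallyRamifiedFrom κ n₀` (Washington, *Introduction to
  Cyclotomic Fields*, §13.1, Lemma 13.3: "there exists `n ≥ 0` such that every prime which ramifies
  in `K_∞/K_n` is totally ramified"): only the finitely many places above `p` can ramify
  (`ZpExtension.inertia_le_kerSubgroup_holds`, Washington Prop. 13.2), each has ONE index by the two
  lemmas above (transitivity of `Γ_K` on the primes above a place,
  `HeightOneSpectrum.exists_smul_eq_of_mem_primesAbove_holds`), and `n₀` is their maximum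
  (`ZpExtension.layerSubgroup_antitone`);
* `exists_totallyRamifiedFrom_of_isAnticyclotomic` — for `K` imaginary quadratic, `p` odd and `κ`
  ANTICYCLOTOMIC: some layer `K_{n₀}` above which EVERY prime of `\bar ℤ_K` over `p` is totally
  ramified in `K_∞` (Brink 2007, Cor. 1: the anticyclotomic tower is ramified at every prime above
  `p`, tree `ZpExtension.inertia_not_le_kerSubgroup_of_isAnticyclotomic`), and
  `exists_layerSubgroup_le_decompositionSubgroup_sup_of_isAnticyclotomic` — hence non-split above
  `K_{n₀}` (one prime of `K_∞` over each prime of `K_{n₀}` above `p`).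

* `exists_inertia_not_le_kerSubgroup` / `exists_totallyRamifiedFrom_and_layerSubgroup_le` (§3, `p`
  odd) — the FIRST half of Washington's Lemma 13.3: some prime above `p` ramifies in `K_∞/K` (finiteness
  of the Hilbert class field, as in Brink's anticyclotomic instance), hence is totally ramified above the
  index.

WHY (consumer by name). The anticyclotomic signed/BDP Iwasawa theory typed in the tree
(`AcSigned.Setting`, flag `tot-ram-via-h_K` of `AnticyclotomicSignedSelmer.lean`: "the facts carry
`p ∤ h_K` (`Setting.not_dvd_classNumber`), the printed sufficient condition, in place of 'the primes
above `p` are totally ramified in `K_∞/K`' (TODO(general form): `ZpExtension.TotallyRamifiedFrom κ 0`)")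
reaches only `p ∤ h_K`; the BSD route `SignedBaseChange`, crux `AnticyclotomicEisensteinDivisibility`
(stmt-BirchSwinnertonDyer-20727), line `bdpline` v24, keeps TWO registered research stubs on the
complementary cell `p ∣ h_K` (`stub_xAcTorsionSS_classDvd`, `stub_bdpLowerHalfRatSS_classDvd`), where the
primes above `p` may split or stay unramified in the first layers of `K_∞⁻/K`. The last two theorems are
the unconditional replacement of `Setting.not_dvd_classNumber` on that cell: a layer `K_{n₀}` from which
on the two primes above `p` are totally ramified and non-split — the base field over which the printed
arguments (Kobayashi / B.-D. Kim / Castella–Wan, all over a totally ramified local tower) would have to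
be re-run. Nothing here concerns an elliptic curve; BSD is not advanced by this file.

References: [Washington1997] L. C. Washington, *Introduction to Cyclotomic Fields*, 2nd ed., GTM 83,
§13.1 Prop. 13.2 and Lemma 13.3; [Brink2007] D. Brink, *Prime decomposition in the anti-cyclotomic
extension*, Math. Comp. 76 (2007), Cor. 1 (p. 2136); [Fukuda1994] T. Fukuda, Proc. Japan Acad. 70
(1994), p. 264 (the index `n₀`); [SerreGaloisCohomology1997] I §1.4 (closed subgroups of `ℤ_p`).
-/

noncomputable section

open scoped NumberField Pointwise
open Multiplicative

universe u

namespace Literature.NumberTheory.IwasawaTheory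

open Literature.NumberTheory.EllipticCurves Literature.NumberTheory.GaloisRepresentations Field
  IsDedekindDomain NumberField

/-! ## §1 Every `ℤ_p`-extension of a number field has a Fukuda index -/

section General

variable {K : Type u} [Field K] [NumberField K] {p : ℕ} [Fact p.Prime]

omit [NumberField K] in
/-- **The inertia group of a prime of `K_∞` in the abelian group `Gal(K_∞/K)` does not depend on the
prime of `\bar ℤ_K` chosen above the place**: `I_{τ•𝔓} · Gal(K̄/K_∞) = I_𝔓 · Gal(K̄/K_∞)` as subgroups
of `Γ_K` (`I_{τ•𝔓} = τ I_𝔓 τ⁻¹`, `Ideal.inertia_smul`, and `τστ⁻¹ ≡ σ` modulo the kernel of the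
homomorphism `κ` to the commutative group `ℤ_p`). [cite: Washington1997, §13.1 (proof of Lemma 13.3)] -/
theorem inertia_smul_sup_kerSubgroup (κ : ZpExtension K p) (𝔓 : Ideal (absIntegers (𝓞 K) K))
    (τ : absoluteGaloisGroup K) :
    (τ • 𝔓).inertia (absoluteGaloisGroup K) ⊔ κ.kerSubgroup =
      𝔓.inertia (absoluteGaloisGroup K) ⊔ κ.kerSubgroup := by
  -- membership in the inertia group of the conjugate prime (`Ideal.inertia_smul`)
  have hiff : ∀ σ : absoluteGaloisGroup K, σ ∈ (τ • 𝔓).inertia (absoluteGaloisGroup K) ↔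
      τ⁻¹ * σ * τ ∈ 𝔓.inertia (absoluteGaloisGroup K) := fun σ ↦ by
    rw [Ideal.inertia_smul, Subgroup.mem_pointwise_smul_iff_inv_smul_mem, MulAut.smul_def,
      MulAut.conj_inv_apply]
  -- `κ`, valued in the commutative group `ℤ_p`, kills commutators
  have hcomm : ∀ a b : absoluteGaloisGroup K, (a * b * a⁻¹)⁻¹ * b ∈ κ.kerSubgroup := by
    intro a b
    rw [ZpExtension.mem_kerSubgroup]
    apply Multiplicative.toAdd.injective
    simp only [map_mul, map_inv, toAdd_mul, toAdd_inv, toAdd_one]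
    ring
  apply le_antisymm
  · refine sup_le (fun σ hσ ↦ ?_) le_sup_right
    have h1 : τ⁻¹ * σ * τ ∈ 𝔓.inertia (absoluteGaloisGroup K) := (hiff σ).mp hσ
    have h2 := hcomm τ⁻¹ σ
    rw [inv_inv] at h2
    have h3 := Subgroup.mul_mem_sup h1 h2
    rwa [mul_inv_cancel_left] at h3
  · refine sup_le (fun σ hσ ↦ ?_) le_sup_right
    have h1 : τ * σ * τ⁻¹ ∈ (τ • 𝔓).inertia (absoluteGaloisGroup K) := by
      rw [hiff, show τ⁻¹ * (τ * σ * τ⁻¹) * τ = σ by group]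
      exact hσ
    have h3 := Subgroup.mul_mem_sup h1 (hcomm τ σ)
    rwa [mul_inv_cancel_left] at h3

/-- **Dichotomy for one prime `𝔓` of `\bar ℤ_K`**: either `I_𝔓 ≤ Gal(K̄/K_∞)` (the prime of `K_∞` below
`𝔓` is unramified in `K_∞/K`) or `Gal(K̄/K_e) ≤ I_𝔓 · Gal(K̄/K_∞)` for some `e` (it is totally ramified
in `K_∞/K_e`). Proof: `I_𝔓` is closed in the compact group `Γ_K`
(`absIntegers.isClosed_inertia_holds`), so its image under the continuous `κ` is a closed subgroup of
`ℤ_p`, i.e. `0` or `p^e ℤ_p` (`Literature.GroupTheory.kappa_eq_one_or_exists_image_eq_span_pow`); in the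
second case every `σ` with `p^e ∣ κ σ` is `g · (g⁻¹σ)` with `g ∈ I_𝔓`, `κ g = κ σ`.
[cite: Washington1997, §13.1 (proof of Lemma 13.3)] [cite: SerreGaloisCohomology1997, I §1.4] -/
theorem inertia_le_kerSubgroup_or_exists_layerSubgroup_le (κ : ZpExtension K p)
    (𝔓 : Ideal (absIntegers (𝓞 K) K)) :
    𝔓.inertia (absoluteGaloisGroup K) ≤ κ.kerSubgroup ∨
      ∃ e : ℕ, κ.layerSubgroup e ≤ 𝔓.inertia (absoluteGaloisGroup K) ⊔ κ.kerSubgroup := by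
  classical
  set I : Subgroup (absoluteGaloisGroup K) := 𝔓.inertia (absoluteGaloisGroup K) with hI
  haveI : CompactSpace I := isCompact_iff_compactSpace.mp
    (absIntegers.isClosed_inertia_holds (R := 𝓞 K) (K := K) 𝔓).isCompact
  let κI : I →ₜ* Multiplicative ℤ_[p] :=
    { toMonoidHom := κ.toContinuousMonoidHom.toMonoidHom.comp I.subtype
      continuous_toFun := κ.toContinuousMonoidHom.continuous.comp continuous_subtype_val }
  have hκI : ∀ g : I, κI g = κ (g : absoluteGaloisGroup K) := fun _ ↦ rfl
  rcases Literature.GroupTheory.kappa_eq_one_or_exists_image_eq_span_pow κI with h | ⟨e, -, hsurj⟩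
  · left
    intro σ hσ
    rw [ZpExtension.mem_kerSubgroup, ← hκI ⟨σ, hσ⟩]
    exact h _
  · right
    refine ⟨e, fun σ hσ ↦ ?_⟩
    rw [ZpExtension.mem_layerSubgroup] at hσ
    obtain ⟨g, hg⟩ := hsurj (toAdd (κ σ)) (Ideal.mem_span_singleton.mpr hσ)
    rw [hκI] at hg
    have hg' : κ (g : absoluteGaloisGroup K) = κ σ := Multiplicative.toAdd.injective hg
    have hmem : (g : absoluteGaloisGroup K)⁻¹ * σ ∈ κ.kerSubgroup := by
      rw [ZpExtension.mem_kerSubgroup, map_mul, map_inv, hg', inv_mul_cancel]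
    have hσeq : σ = (g : absoluteGaloisGroup K) * ((g : absoluteGaloisGroup K)⁻¹ * σ) := by group
    rw [hσeq]
    exact Subgroup.mul_mem_sup g.2 hmem

/-- **Washington, Lemma 13.3 (existence of the index): every `ℤ_p`-extension `K_∞/K` of a number field
admits `n₀ ≥ 0` such that every prime which ramifies in `K_∞/K` is totally ramified in `K_∞/K_{n₀}`**
— `∃ n₀, TotallyRamifiedFrom κ n₀` (Fukuda's standing index). Printed proof: "only finitely many
primes ramify in `K_∞/K` [those above `p`, Prop. 13.2] … the inertia group of each is a closed subgroup
`p^{e}ℤ_p` of `ℤ_p ≃ Gal(K_∞/K)`; take `n₀ = max e`." Here: places `w ∤ p` are unramified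
(`ZpExtension.inertia_le_kerSubgroup_holds`); the places above `p` form a finite set
(`Ideal.finite_factors`); above each, all primes of `\bar ℤ_K` are `Γ_K`-conjugate
(`HeightOneSpectrum.exists_smul_eq_of_mem_primesAbove_holds`) and share one index
(`inertia_smul_sup_kerSubgroup`, `inertia_le_kerSubgroup_or_exists_layerSubgroup_le`); `n₀` is the
maximum (`ZpExtension.layerSubgroup_antitone`). [cite: Washington1997, §13.1 Lemma 13.3 and Prop. 13.2]
[cite: Fukuda1994, p. 264] -/
theorem exists_totallyRamifiedFrom (κ : ZpExtension K p) :
    ∃ n₀ : ℕ, TotallyRamifiedFrom κ n₀ := by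
  classical
  have hp : p.Prime := Fact.out
  -- one index for every finite place
  have hex : ∀ w : HeightOneSpectrum (𝓞 K), ∃ e : ℕ, ∀ 𝔓 ∈ w.primesAbove,
      𝔓.inertia (absoluteGaloisGroup K) ≤ κ.kerSubgroup ∨
        κ.layerSubgroup e ≤ 𝔓.inertia (absoluteGaloisGroup K) ⊔ κ.kerSubgroup := by
    intro w
    obtain ⟨𝔓₀, h𝔓₀⟩ := w.primesAbove_nonempty
    rcases inertia_le_kerSubgroup_or_exists_layerSubgroup_le κ 𝔓₀ with h0 | ⟨e, he⟩
    · refine ⟨0, fun 𝔓 h𝔓 ↦ Or.inl ?_⟩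
      obtain ⟨τ, rfl⟩ :=
        HeightOneSpectrum.exists_smul_eq_of_mem_primesAbove_holds (v := w) h𝔓₀ h𝔓
      calc (τ • 𝔓₀).inertia (absoluteGaloisGroup K)
          ≤ (τ • 𝔓₀).inertia (absoluteGaloisGroup K) ⊔ κ.kerSubgroup := le_sup_left
        _ = 𝔓₀.inertia (absoluteGaloisGroup K) ⊔ κ.kerSubgroup :=
          inertia_smul_sup_kerSubgroup κ 𝔓₀ τ
        _ ≤ κ.kerSubgroup := sup_le h0 le_rfl
    · refine ⟨e, fun 𝔓 h𝔓 ↦ Or.inr ?_⟩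
      obtain ⟨τ, rfl⟩ :=
        HeightOneSpectrum.exists_smul_eq_of_mem_primesAbove_holds (v := w) h𝔓₀ h𝔓
      rw [inertia_smul_sup_kerSubgroup κ 𝔓₀ τ]
      exact he
  choose e he using hex
  -- the finitely many places above `p`
  have hfin : {w : HeightOneSpectrum (𝓞 K) | ((p : ℕ) : 𝓞 K) ∈ w.asIdeal}.Finite := by
    have hne : (Ideal.span {((p : ℕ) : 𝓞 K)} : Ideal (𝓞 K)) ≠ ⊥ := by
      rw [Ne, Ideal.span_singleton_eq_bot]
      exact_mod_cast hp.ne_zero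
    refine (Ideal.finite_factors hne).subset fun w hw ↦ ?_
    exact Ideal.dvd_span_singleton.mpr hw
  refine ⟨hfin.toFinset.sup e, fun w 𝔓 h𝔓 ↦ ?_⟩
  by_cases hpw : ((p : ℕ) : 𝓞 K) ∈ w.asIdeal
  · rcases he w 𝔓 h𝔓 with h | h
    · exact Or.inl h
    · exact Or.inr ((κ.layerSubgroup_antitone
        (Finset.le_sup (f := e) (hfin.mem_toFinset.mpr hpw))).trans h)
  · exact Or.inl (ZpExtension.inertia_le_kerSubgroup_holds K p κ hpw h𝔓)

/-- Pointwise reading of `exists_totallyRamifiedFrom` at a RAMIFIED prime: if `I_𝔓` is not contained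
in `Gal(K̄/K_∞)`, then `Gal(K̄/K_{n₀}) ≤ I_𝔓 · Gal(K̄/K_∞)` for the index `n₀` of the lemma — the prime
of `K_{n₀}` below `𝔓` is totally ramified in `K_∞/K_{n₀}`. [cite: Washington1997, §13.1 Lemma 13.3] -/
theorem exists_forall_layerSubgroup_le_of_not_le (κ : ZpExtension K p) :
    ∃ n₀ : ℕ, ∀ (w : HeightOneSpectrum (𝓞 K)) (𝔓 : Ideal (absIntegers (𝓞 K) K)),
      𝔓 ∈ w.primesAbove → ¬ 𝔓.inertia (absoluteGaloisGroup K) ≤ κ.kerSubgroup →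
        κ.layerSubgroup n₀ ≤ 𝔓.inertia (absoluteGaloisGroup K) ⊔ κ.kerSubgroup := by
  obtain ⟨n₀, h⟩ := exists_totallyRamifiedFrom κ
  exact ⟨n₀, fun w 𝔓 h𝔓 hram ↦ (h w 𝔓 h𝔓).resolve_left hram⟩

end General

/-! ## §2 The anticyclotomic tower of an imaginary quadratic field: a layer above which the primes
over `p` are totally ramified and non-split -/

section Anticyclotomic

variable {K : Type} [Field K] [NumberField K] {p : ℕ} [Fact p.Prime]

/-- **In the anticyclotomic `ℤ_p`-extension `K_∞⁻/K` of an imaginary quadratic field (`p` odd) there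
is a layer `K_{n₀}` such that EVERY prime of `\bar ℤ_K` above `p` is totally ramified in `K_∞⁻/K_{n₀}`**
(`Gal(K̄/K_{n₀}) ≤ I_𝔓 · Gal(K̄/K_∞⁻)`), together with Fukuda's index property for all places. Brink
2007, Cor. 1 ("the prime `l` is (infinitely) ramified in `K^anti`, since otherwise `K^anti` would be an
infinite unramified extension of `K`") — tree `ZpExtension.inertia_not_le_kerSubgroup_of_isAnticyclotomic`
— excludes the unramified branch of `exists_totallyRamifiedFrom` above `p`. No hypothesis on the class
number of `K` and none on the splitting of `p` in `K`: at `p ∤ h_K` one may take `n₀ = 0` (the printed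
sufficient condition of `AcSigned.Setting`); this is the statement that survives at `p ∣ h_K`.
[cite: Brink2007, Cor. 1 (p. 2136)] [cite: Washington1997, §13.1 Lemma 13.3] -/
theorem exists_totallyRamifiedFrom_of_isAnticyclotomic (hK : IsImaginaryQuadratic K) (hp2 : p ≠ 2)
    (κ : ZpExtension K p) (hκ : κ.IsAnticyclotomic) :
    ∃ n₀ : ℕ, TotallyRamifiedFrom κ n₀ ∧
      ∀ (v : HeightOneSpectrum (𝓞 K)), ((p : ℕ) : 𝓞 K) ∈ v.asIdeal →
        ∀ 𝔓 ∈ v.primesAbove,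
          κ.layerSubgroup n₀ ≤ 𝔓.inertia (absoluteGaloisGroup K) ⊔ κ.kerSubgroup := by
  obtain ⟨n₀, h⟩ := exists_totallyRamifiedFrom κ
  refine ⟨n₀, h, fun v hpv 𝔓 h𝔓 ↦ (h v 𝔓 h𝔓).resolve_left ?_⟩
  exact ZpExtension.inertia_not_le_kerSubgroup_of_isAnticyclotomic hK hp2 κ hκ hpv h𝔓

/-- **Non-splitting above the index**: in the situation of
`exists_totallyRamifiedFrom_of_isAnticyclotomic`, `Gal(K̄/K_{n₀}) ≤ D_𝔓 · Gal(K̄/K_∞⁻)` for every prime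
`𝔓` of `\bar ℤ_K` above `p` — the decomposition group of `𝔓` surjects onto `Gal(K_∞⁻/K_{n₀})`, i.e. the
prime of `K_{n₀}` below `𝔓` has exactly one prime of `K_∞⁻` above it (`I_𝔓 ≤ D_𝔓`,
`Ideal.inertia_le_stabilizer`). At `p ∤ h_K` and `p` split this is the tree's `AcSigned.IsNonsplitIn`
with `n₀ = 0` (`…SignedBaseChangeAcDivAnticyclotomicNonsplit`); here unconditionally from some layer on.
[cite: Brink2007, Cor. 1 (p. 2136)] [cite: Washington1997, §13.1 Lemma 13.3] -/
theorem exists_layerSubgroup_le_decompositionSubgroup_sup_of_isAnticyclotomic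
    (hK : IsImaginaryQuadratic K) (hp2 : p ≠ 2) (κ : ZpExtension K p) (hκ : κ.IsAnticyclotomic) :
    ∃ n₀ : ℕ, ∀ (v : HeightOneSpectrum (𝓞 K)), ((p : ℕ) : 𝓞 K) ∈ v.asIdeal →
      ∀ 𝔓 ∈ v.primesAbove,
        κ.layerSubgroup n₀ ≤ 𝔓.inertia (absoluteGaloisGroup K) ⊔ κ.kerSubgroup ∧
          κ.layerSubgroup n₀ ≤ 𝔓.decompositionSubgroup (absoluteGaloisGroup K) ⊔ κ.kerSubgroup := by
  obtain ⟨n₀, -, h⟩ := exists_totallyRamifiedFrom_of_isAnticyclotomic hK hp2 κ hκ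
  refine ⟨n₀, fun v hpv 𝔓 h𝔓 ↦ ⟨h v hpv 𝔓 h𝔓, (h v hpv 𝔓 h𝔓).trans ?_⟩⟩
  exact sup_le_sup_right (Ideal.inertia_le_stabilizer 𝔓) _

end Anticyclotomic

/-! ## §3 Washington, Lemma 13.3 (first half): at an odd prime `p`, some prime above `p` ramifies in
every `ℤ_p`-extension, hence is totally ramified above the Fukuda index -/

section Ramified

variable {K : Type} [Field K] [NumberField K] {p : ℕ} [Fact p.Prime]

/-- **Washington, Lemma 13.3 (first half): in a `ℤ_p`-extension `K_∞/K` of a number field at least one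
prime ramifies** — here for `p` odd, in inertia form: some prime `𝔓` of `\bar ℤ_K` above a place `v ∣ p`
has `I_𝔓 ⊄ Gal(K̄/K_∞)`. Printed proof: "the class number of `K` is finite, so the maximal unramified
abelian extension is finite; `K_∞/K` must be ramified at some prime; by Prop. 13.2 it lies above `p`".
Here exactly as the tree's anticyclotomic instance `ZpExtension.inertia_not_le_kerSubgroup_of_isAnticyclotomic`
(Brink): if every inertia group above `p` lay in `ker κ` then, with Washington Prop. 13.2 away from `p`
(`ZpExtension.inertia_le_kerSubgroup_holds`), every layer `K_n/K` — abelian of degree `pⁿ`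
(`ZpExtension.finrank_layer_holds`), unramified at all finite places
(`ZpExtension.isUnramifiedIn_layer_of_forall_inertia_le`) and at infinity (`pⁿ` odd,
`IsUnramifiedAtInfinitePlaces_of_odd_finrank`) — would give `pⁿ ∣ h_K`
(`hilbertClassField.finrank_dvd_classNumber_of_abelian`) for every `n`. `K : Type` (universe of the
tree's Hilbert class field). -- TODO(general form): `p = 2` (real places stay real since `ℤ_2` is torsion-free).
[cite: Washington1997, §13.1 Lemma 13.3 and Prop. 13.2] [cite: Cox2013, §5.C Cor. 5.24] -/
theorem exists_inertia_not_le_kerSubgroup (hp2 : p ≠ 2) (κ : ZpExtension K p) :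
    ∃ (v : HeightOneSpectrum (𝓞 K)) (𝔓 : Ideal (absIntegers (𝓞 K) K)),
      ((p : ℕ) : 𝓞 K) ∈ v.asIdeal ∧ 𝔓 ∈ v.primesAbove ∧
        ¬ 𝔓.inertia (absoluteGaloisGroup K) ≤ κ.kerSubgroup := by
  by_contra hcon
  push Not at hcon
  have hp : p.Prime := Fact.out
  have hI : ∀ (w : HeightOneSpectrum (𝓞 K)) (𝔓 : Ideal (absIntegers (𝓞 K) K)),
      𝔓 ∈ w.primesAbove → 𝔓.inertia (absoluteGaloisGroup K) ≤ κ.kerSubgroup := by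
    intro w 𝔓 h𝔓
    by_cases hpw : ((p : ℕ) : 𝓞 K) ∈ w.asIdeal
    · exact hcon w 𝔓 hpw h𝔓
    · exact ZpExtension.inertia_le_kerSubgroup_holds K p κ hpw h𝔓
  -- every layer has degree `pⁿ` dividing the class number
  have hdvd : ∀ n : ℕ, p ^ n ∣ Fintype.card (ClassGroup (𝓞 K)) := by
    intro n
    haveI : FiniteDimensional K (κ.layer n) := κ.finiteDimensional_layer_holds n
    haveI : IsGalois K (κ.layer n) := κ.isGalois_layer_holds n
    haveI : IsAbelianGalois K (κ.layer n) := κ.isAbelianGalois_layer n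
    haveI : NumberField (κ.layer n) := NumberField.of_module_finite K (κ.layer n)
    haveI : IsUnramifiedAtInfinitePlaces K (κ.layer n) :=
      IsUnramifiedAtInfinitePlaces_of_odd_finrank
        (by rw [κ.finrank_layer_holds n]; exact (hp.odd_of_ne_two hp2).pow)
    have h := Literature.NumberTheory.NumberFields.hilbertClassField.finrank_dvd_classNumber_of_abelian
      K (κ.layer n) (fun w ↦ ZpExtension.isUnramifiedIn_layer_of_forall_inertia_le κ hI n w)
    rwa [κ.finrank_layer_holds n] at h
  have hpos : 0 < Fintype.card (ClassGroup (𝓞 K)) := Fintype.card_pos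
  exact absurd (Nat.le_of_dvd hpos (hdvd _)) (not_le.mpr (Nat.lt_pow_self hp.one_lt))

/-- **Washington, Lemma 13.3, both halves together (`p` odd): there are an index `n₀` and a prime
`𝔓` of `\bar ℤ_K` above `p` that is TOTALLY ramified in `K_∞/K_{n₀}`** (`Gal(K̄/K_{n₀}) ≤ I_𝔓 ·
Gal(K̄/K_∞)`), the index being Fukuda's for all places (`TotallyRamifiedFrom κ n₀`).
[cite: Washington1997, §13.1 Lemma 13.3] -/
theorem exists_totallyRamifiedFrom_and_layerSubgroup_le (hp2 : p ≠ 2) (κ : ZpExtension K p) :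
    ∃ n₀ : ℕ, TotallyRamifiedFrom κ n₀ ∧
      ∃ (v : HeightOneSpectrum (𝓞 K)) (𝔓 : Ideal (absIntegers (𝓞 K) K)),
        ((p : ℕ) : 𝓞 K) ∈ v.asIdeal ∧ 𝔓 ∈ v.primesAbove ∧
          κ.layerSubgroup n₀ ≤ 𝔓.inertia (absoluteGaloisGroup K) ⊔ κ.kerSubgroup := by
  obtain ⟨n₀, h⟩ := exists_totallyRamifiedFrom κ
  obtain ⟨v, 𝔓, hpv, h𝔓, hram⟩ := exists_inertia_not_le_kerSubgroup hp2 κ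
  exact ⟨n₀, h, v, 𝔓, hpv, h𝔓, (h v 𝔓 h𝔓).resolve_left hram⟩

end Ramified

end Literature.NumberTheory.IwasawaTheory

end
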